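import Summits.NavierStokesRegularity.OSWSelfSimilar.SheetRLinearisedTests
import HarnessLib

/-!
# SHEET-ℝ frame, linearised operator: the cutoff identity and the cutoff estimates on the energy class

HONEST FRAMING (cell ns-blowup GROUP B / zone Z3, cases Z3-SR-CERT / Z3-SR-SPEC; 1-D MODEL certificate frame (viscous gCLM/OSW sheet
on the line); not Euler/NS; «violates: none — MODEL»). Nothing here asserts that a profile exists.

Second file of the uniqueness argument for weak solutions of `𝓛u = −u″ + d u′ + V u` in the energy class `E = H¹_w`, `w = L² + ξ²`
(vocabulary: `SheetRLinearisedTests`; conclusion: `SheetRLinearisedUniqueness`).  With the cutoff `χ = χ_R`, `v = χu`,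
`v₁ = χ′u + χu₁`, `φ = χv = χ²u`, `φ₁ = χ′v + χv₁`:

* §1 `integrand_cutoff_identity` — POINTWISE, the integrand of `linForm(u; φ)` equals the integrand of `linForm(v; v)` minus the
  correction `(wχ′² + 2ξχχ′ + w d χχ′)u²` (pure algebra: the first-order term `½ξ∂`, unbounded on `E × E`, never has to be integrated by
  parts, and the potential terms cancel exactly);
* §2 `integrable_diag` — for `u` in the energy class, `R ≥ 1`, `|χ_R′| ≤ M/R`, drift `|d| ≤ D₀ + D₁|ξ|` and potential `|V| ≤ V₀`, the
  diagonal integrand of `linForm(v; v)` is integrable (the drift term uses the compact support: `|d| ≤ D₀ + 2D₁R` where `χ ≠ 0`);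
  `corr_le` — the correction is bounded pointwise by `C·𝟙{R² ≤ ξ²}·w u²`, `C = M² + 4M/L² + M(D₀ + 2D₁)` (R-INDEPENDENT: `|ξχ_R′| ≤ 2M`
  absorbs the `1/R`), hence `∫ corr ≤ C·∫_{R² ≤ ξ²} w u²` — a TAIL of the weighted mass.
Pure calculus; no definition, no named fact. WHAT THIS IS NOT: not NS; no number of record moves.
-/

noncomputable section

namespace Summit.NavierStokesRegularity.OSWSelfSimilar
namespace SheetRLinearisedCutoffEstimates

open _root_.MeasureTheory _root_.Set _root_.Filter _root_.Real SheetRWeakProfilePV SheetRWeakToStrong SheetREnergyClass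
  SheetRLinearisedTests
open scoped Topology

/-! ### §1 The pointwise cutoff identity -/

/-- **The cutoff identity, pointwise.** With `v = χu`, `v₁ = χ′u + χu₁`, `φ = χv`, `φ₁ = χ′v + χv₁` (so `φ = χ²u`), the integrand of
`linForm(u; φ)` equals the integrand of `linForm(v; v)` minus `(wχ′² + 2ξχχ′ + w d χχ′)u²` — an algebraic identity, no integration by
parts (the potential terms cancel exactly). [folklore] -/
theorem integrand_cutoff_identity (L : ℝ) (d V u u₁ χ χ' : ℝ → ℝ) (ξ : ℝ) :
    (L ^ 2 + ξ ^ 2) * (u₁ ξ * (χ' ξ * (χ ξ * u ξ) + χ ξ * (χ' ξ * u ξ + χ ξ * u₁ ξ)))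
      + 2 * ξ * (u₁ ξ * (χ ξ * (χ ξ * u ξ))) + (L ^ 2 + ξ ^ 2) * d ξ * (u₁ ξ * (χ ξ * (χ ξ * u ξ)))
      + (L ^ 2 + ξ ^ 2) * V ξ * (u ξ * (χ ξ * (χ ξ * u ξ)))
    = ((L ^ 2 + ξ ^ 2) * ((χ' ξ * u ξ + χ ξ * u₁ ξ) * (χ' ξ * u ξ + χ ξ * u₁ ξ))
        + 2 * ξ * ((χ' ξ * u ξ + χ ξ * u₁ ξ) * (χ ξ * u ξ))
        + (L ^ 2 + ξ ^ 2) * d ξ * ((χ' ξ * u ξ + χ ξ * u₁ ξ) * (χ ξ * u ξ))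
        + (L ^ 2 + ξ ^ 2) * V ξ * ((χ ξ * u ξ) * (χ ξ * u ξ)))
      - ((L ^ 2 + ξ ^ 2) * χ' ξ ^ 2 + 2 * ξ * (χ ξ * χ' ξ) + (L ^ 2 + ξ ^ 2) * d ξ * (χ ξ * χ' ξ)) * u ξ ^ 2 := by
  ring

/-! ### §2 Integrability of the diagonal integrand and of the correction; the size of the correction -/

section Estimates

variable {L D₀ D₁ V₀ R M : ℝ} {d V u u₁ : ℝ → ℝ}

/-- For `u` in the energy class, `R ≥ 1` and a cutoff-derivative bound `|χ_R′| ≤ M/R`: the diagonal integrand of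
`linForm(χ_R u; χ_R u)` is integrable. [folklore] -/
theorem integrable_diag (hL : 0 < L) (hdm : AEStronglyMeasurable d volume) (hVm : AEStronglyMeasurable V volume)
    (hD₀ : 0 ≤ D₀) (hD₁ : 0 ≤ D₁) (hd : ∀ ξ, |d ξ| ≤ D₀ + D₁ * |ξ|) (hV : ∀ ξ, |V ξ| ≤ V₀)
    (hu : ∀ x, u x = u 0 + ∫ s in (0 : ℝ)..x, u₁ s) (hu₁m : AEStronglyMeasurable u₁ volume)
    (h0 : Integrable fun y => (L ^ 2 + y ^ 2) * u y ^ 2) (h1 : Integrable fun y => (L ^ 2 + y ^ 2) * u₁ y ^ 2)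
    (hR : 1 ≤ R) (hM0 : 0 ≤ M) (hM : ∀ ξ, |deriv (cutoff R) ξ| ≤ M / R) :
    Integrable (fun ξ => (L ^ 2 + ξ ^ 2) * ((deriv (cutoff R) ξ * u ξ + cutoff R ξ * u₁ ξ) *
          (deriv (cutoff R) ξ * u ξ + cutoff R ξ * u₁ ξ))
        + 2 * ξ * ((deriv (cutoff R) ξ * u ξ + cutoff R ξ * u₁ ξ) * (cutoff R ξ * u ξ))
        + (L ^ 2 + ξ ^ 2) * d ξ * ((deriv (cutoff R) ξ * u ξ + cutoff R ξ * u₁ ξ) * (cutoff R ξ * u ξ))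
        + (L ^ 2 + ξ ^ 2) * V ξ * ((cutoff R ξ * u ξ) * (cutoff R ξ * u ξ))) := by
  have hR0 : 0 < R := by linarith
  obtain ⟨huc, hu₁2, hu2, -, -⟩ := basic_of_primitive hL hu hu₁m h0 h1
  set χ : ℝ → ℝ := cutoff R with hχ
  set χ' : ℝ → ℝ := deriv (cutoff R) with hχ'
  have hχc : Continuous χ := (contDiff_cutoff R).continuous
  have hχ'c : Continuous χ' := (hasDerivAt_cutoff R 0).2
  have hχb : ∀ ξ, 0 ≤ χ ξ ∧ χ ξ ≤ 1 := fun ξ => cutoff_nonneg_le_one R ξ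
  have hχ'b : ∀ ξ, |χ' ξ| ≤ M := fun ξ => (hM ξ).trans (div_le_self hM0 hR)
  have hξ_of_χ : ∀ ξ, χ ξ ≠ 0 → |ξ| ≤ 2 * R := by
    intro ξ hne
    by_contra hlt
    exact hne (cutoff_and_deriv_eq_zero hR0 (not_le.1 hlt).le).1
  have hw : ∀ ξ : ℝ, 0 < L ^ 2 + ξ ^ 2 := fun ξ => by positivity
  have hu2i : Integrable fun ξ => u ξ ^ 2 := hu2.integrable_sq
  -- measurability
  have hum : AEStronglyMeasurable u volume := huc.aestronglyMeasurable
  have hv₁m : AEStronglyMeasurable (fun ξ => χ' ξ * u ξ + χ ξ * u₁ ξ) volume :=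
    (hχ'c.aestronglyMeasurable.mul hum).add (hχc.aestronglyMeasurable.mul hu₁m)
  have hvm : AEStronglyMeasurable (fun ξ => χ ξ * u ξ) volume := hχc.aestronglyMeasurable.mul hum
  have hwm : AEStronglyMeasurable (fun ξ : ℝ => L ^ 2 + ξ ^ 2) volume := by fun_prop
  have h2ξm : AEStronglyMeasurable (fun ξ : ℝ => 2 * ξ) volume := by fun_prop
  -- pointwise bounds on `v₁²`, `v²`
  have hv₁sq : ∀ ξ, (χ' ξ * u ξ + χ ξ * u₁ ξ) ^ 2 ≤ 2 * (M ^ 2 * u ξ ^ 2 + u₁ ξ ^ 2) := by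
    intro ξ
    have h1 : (χ' ξ * u ξ) ^ 2 ≤ M ^ 2 * u ξ ^ 2 := by
      rw [mul_pow, ← sq_abs (χ' ξ)]
      exact mul_le_mul_of_nonneg_right (pow_le_pow_left₀ (abs_nonneg _) (hχ'b ξ) 2) (sq_nonneg _)
    have h2 : (χ ξ * u₁ ξ) ^ 2 ≤ u₁ ξ ^ 2 := by
      rw [mul_pow]
      obtain ⟨h0', h1'⟩ := hχb ξ
      have : χ ξ ^ 2 ≤ 1 := by nlinarith
      nlinarith [sq_nonneg (u₁ ξ)]
    nlinarith [sq_nonneg (χ' ξ * u ξ - χ ξ * u₁ ξ)]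
  have hvsq : ∀ ξ, (χ ξ * u ξ) ^ 2 ≤ u ξ ^ 2 := by
    intro ξ
    rw [mul_pow]
    obtain ⟨h0', h1'⟩ := hχb ξ
    have : χ ξ ^ 2 ≤ 1 := by nlinarith
    nlinarith [sq_nonneg (u ξ)]
  -- the common majorant `G = 2(M² w u² + w u₁²)` of `w v₁²`
  have hG : Integrable fun ξ => 2 * (M ^ 2 * ((L ^ 2 + ξ ^ 2) * u ξ ^ 2) + (L ^ 2 + ξ ^ 2) * u₁ ξ ^ 2) :=
    ((h0.const_mul (M ^ 2)).add h1).const_mul 2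
  have hwv₁ : ∀ ξ, (L ^ 2 + ξ ^ 2) * (χ' ξ * u ξ + χ ξ * u₁ ξ) ^ 2 ≤
      2 * (M ^ 2 * ((L ^ 2 + ξ ^ 2) * u ξ ^ 2) + (L ^ 2 + ξ ^ 2) * u₁ ξ ^ 2) := by
    intro ξ
    have := mul_le_mul_of_nonneg_left (hv₁sq ξ) (hw ξ).le
    nlinarith
  -- T1 = w v₁²
  have hT1 : Integrable fun ξ => (L ^ 2 + ξ ^ 2) * ((χ' ξ * u ξ + χ ξ * u₁ ξ) * (χ' ξ * u ξ + χ ξ * u₁ ξ)) := by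
    refine hG.mono' (hwm.mul (hv₁m.mul hv₁m)) (Eventually.of_forall fun ξ => ?_)
    rw [Real.norm_eq_abs, ← pow_two, abs_of_nonneg (by positivity)]
    exact hwv₁ ξ
  -- T2 = 2ξ v₁ v : |2ξ v₁ v| ≤ ξ² v₁² + v² ≤ w v₁² + u²
  have hT2 : Integrable fun ξ => 2 * ξ * ((χ' ξ * u ξ + χ ξ * u₁ ξ) * (χ ξ * u ξ)) := by
    refine (hG.add hu2i).mono' (h2ξm.mul (hv₁m.mul hvm)) (Eventually.of_forall fun ξ => ?_)
    rw [Real.norm_eq_abs]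
    simp only [Pi.add_apply]
    have key : |2 * ξ * ((χ' ξ * u ξ + χ ξ * u₁ ξ) * (χ ξ * u ξ))| ≤
        ξ ^ 2 * (χ' ξ * u ξ + χ ξ * u₁ ξ) ^ 2 + (χ ξ * u ξ) ^ 2 := by
      rw [abs_le]; constructor <;>
        nlinarith [sq_nonneg (ξ * (χ' ξ * u ξ + χ ξ * u₁ ξ) - χ ξ * u ξ),
          sq_nonneg (ξ * (χ' ξ * u ξ + χ ξ * u₁ ξ) + χ ξ * u ξ)]
    have hξw : ξ ^ 2 * (χ' ξ * u ξ + χ ξ * u₁ ξ) ^ 2 ≤ (L ^ 2 + ξ ^ 2) * (χ' ξ * u ξ + χ ξ * u₁ ξ) ^ 2 :=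
      mul_le_mul_of_nonneg_right (by nlinarith [sq_nonneg L]) (sq_nonneg _)
    linarith [hwv₁ ξ, hvsq ξ]
  -- T3 = w d v₁ v : on the support |d| ≤ D₀ + 2D₁R, and w|v₁||v| ≤ (w v₁² + w v²)/2
  have hT3 : Integrable fun ξ => (L ^ 2 + ξ ^ 2) * d ξ * ((χ' ξ * u ξ + χ ξ * u₁ ξ) * (χ ξ * u ξ)) := by
    have hmaj : Integrable fun ξ => (D₀ + 2 * D₁ * R) / 2 *
        (2 * (M ^ 2 * ((L ^ 2 + ξ ^ 2) * u ξ ^ 2) + (L ^ 2 + ξ ^ 2) * u₁ ξ ^ 2) + (L ^ 2 + ξ ^ 2) * u ξ ^ 2) :=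
      (hG.add h0).const_mul _
    refine hmaj.mono' ((hwm.mul hdm).mul (hv₁m.mul hvm)) (Eventually.of_forall fun ξ => ?_)
    rw [Real.norm_eq_abs]
    by_cases hχ0 : χ ξ = 0
    · rw [hχ0]
      simp only [zero_mul, mul_zero, abs_zero]
      have := hw ξ
      positivity
    · have hξ : |ξ| ≤ 2 * R := hξ_of_χ ξ hχ0
      have hdξ : |d ξ| ≤ D₀ + 2 * D₁ * R := by
        calc |d ξ| ≤ D₀ + D₁ * |ξ| := hd ξ
          _ ≤ D₀ + D₁ * (2 * R) := by gcongr
          _ = D₀ + 2 * D₁ * R := by ring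
      set a := χ' ξ * u ξ + χ ξ * u₁ ξ with ha
      set b := χ ξ * u ξ with hb
      have hab : |a * b| ≤ (a ^ 2 + b ^ 2) / 2 := by
        rw [abs_le]; constructor <;> nlinarith [sq_nonneg (a - b), sq_nonneg (a + b)]
      rw [abs_mul, abs_mul, abs_of_pos (hw ξ)]
      calc (L ^ 2 + ξ ^ 2) * |d ξ| * |a * b| ≤ (L ^ 2 + ξ ^ 2) * (D₀ + 2 * D₁ * R) * ((a ^ 2 + b ^ 2) / 2) := by
            gcongr
        _ = (D₀ + 2 * D₁ * R) / 2 * ((L ^ 2 + ξ ^ 2) * a ^ 2 + (L ^ 2 + ξ ^ 2) * b ^ 2) := by ring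
        _ ≤ (D₀ + 2 * D₁ * R) / 2 *
            (2 * (M ^ 2 * ((L ^ 2 + ξ ^ 2) * u ξ ^ 2) + (L ^ 2 + ξ ^ 2) * u₁ ξ ^ 2) + (L ^ 2 + ξ ^ 2) * u ξ ^ 2) := by
            have hDR : 0 ≤ (D₀ + 2 * D₁ * R) / 2 := by positivity
            refine mul_le_mul_of_nonneg_left (add_le_add (hwv₁ ξ) ?_) hDR
            exact mul_le_mul_of_nonneg_left (hvsq ξ) (hw ξ).le
  -- T4 = w V v²
  have hT4 : Integrable fun ξ => (L ^ 2 + ξ ^ 2) * V ξ * ((χ ξ * u ξ) * (χ ξ * u ξ)) := by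
    refine (h0.const_mul V₀).mono' ((hwm.mul hVm).mul (hvm.mul hvm)) (Eventually.of_forall fun ξ => ?_)
    rw [Real.norm_eq_abs, ← pow_two, abs_mul, abs_mul, abs_of_pos (hw ξ), abs_of_nonneg (sq_nonneg (χ ξ * u ξ))]
    have hV0 : 0 ≤ V₀ := (abs_nonneg _).trans (hV 0)
    calc (L ^ 2 + ξ ^ 2) * |V ξ| * (χ ξ * u ξ) ^ 2 ≤ (L ^ 2 + ξ ^ 2) * V₀ * u ξ ^ 2 :=
          mul_le_mul (mul_le_mul_of_nonneg_left (hV ξ) (hw ξ).le) (hvsq ξ) (sq_nonneg _)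
            (mul_nonneg (hw ξ).le hV0)
      _ = V₀ * ((L ^ 2 + ξ ^ 2) * u ξ ^ 2) := by ring
  exact ((hT1.add hT2).add hT3).add hT4

/-- For `u` in the energy class, `R ≥ 1` and `|χ_R′| ≤ M/R`: the correction `(wχ′² + 2ξχχ′ + w d χχ′)u²` is bounded pointwise by
`(M² + 4M/L² + M(D₀ + 2D₁))·𝟙{R² ≤ ξ²}·w u²`, hence integrable with integral at most that constant times the TAIL `∫_{R² ≤ ξ²} w u²`. [folklore] -/
theorem corr_le (hL : 0 < L) (hdm : AEStronglyMeasurable d volume) (hD₀ : 0 ≤ D₀) (hD₁ : 0 ≤ D₁)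
    (hd : ∀ ξ, |d ξ| ≤ D₀ + D₁ * |ξ|) (hu : ∀ x, u x = u 0 + ∫ s in (0 : ℝ)..x, u₁ s) (hu₁m : AEStronglyMeasurable u₁ volume)
    (h0 : Integrable fun y => (L ^ 2 + y ^ 2) * u y ^ 2) (h1 : Integrable fun y => (L ^ 2 + y ^ 2) * u₁ y ^ 2)
    (hR : 1 ≤ R) (hM0 : 0 ≤ M) (hM : ∀ ξ, |deriv (cutoff R) ξ| ≤ M / R) :
    (∀ ξ, |((L ^ 2 + ξ ^ 2) * deriv (cutoff R) ξ ^ 2 + 2 * ξ * (cutoff R ξ * deriv (cutoff R) ξ)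
        + (L ^ 2 + ξ ^ 2) * d ξ * (cutoff R ξ * deriv (cutoff R) ξ)) * u ξ ^ 2|
        ≤ (M ^ 2 + 4 * M / L ^ 2 + M * (D₀ + 2 * D₁)) *
          {ξ : ℝ | R ^ 2 ≤ ξ ^ 2}.indicator (fun ξ => (L ^ 2 + ξ ^ 2) * u ξ ^ 2) ξ) ∧
      Integrable (fun ξ => ((L ^ 2 + ξ ^ 2) * deriv (cutoff R) ξ ^ 2 + 2 * ξ * (cutoff R ξ * deriv (cutoff R) ξ)
        + (L ^ 2 + ξ ^ 2) * d ξ * (cutoff R ξ * deriv (cutoff R) ξ)) * u ξ ^ 2) ∧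
      ∫ ξ, ((L ^ 2 + ξ ^ 2) * deriv (cutoff R) ξ ^ 2 + 2 * ξ * (cutoff R ξ * deriv (cutoff R) ξ)
          + (L ^ 2 + ξ ^ 2) * d ξ * (cutoff R ξ * deriv (cutoff R) ξ)) * u ξ ^ 2
        ≤ (M ^ 2 + 4 * M / L ^ 2 + M * (D₀ + 2 * D₁)) * ∫ ξ in {ξ : ℝ | R ^ 2 ≤ ξ ^ 2}, (L ^ 2 + ξ ^ 2) * u ξ ^ 2 := by
  have hR0 : 0 < R := by linarith
  obtain ⟨huc, -, -, -, -⟩ := basic_of_primitive hL hu hu₁m h0 h1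
  set χ : ℝ → ℝ := cutoff R with hχ
  set χ' : ℝ → ℝ := deriv (cutoff R) with hχ'
  set C : ℝ := M ^ 2 + 4 * M / L ^ 2 + M * (D₀ + 2 * D₁) with hC
  have hχc : Continuous χ := (contDiff_cutoff R).continuous
  have hχ'c : Continuous χ' := (hasDerivAt_cutoff R 0).2
  have hχb : ∀ ξ, 0 ≤ χ ξ ∧ χ ξ ≤ 1 := fun ξ => cutoff_nonneg_le_one R ξ
  have hχ'R : ∀ ξ, |χ' ξ| ≤ M / R := hM
  have hχ'b : ∀ ξ, |χ' ξ| ≤ M := fun ξ => (hM ξ).trans (div_le_self hM0 hR)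
  have hw : ∀ ξ : ℝ, 0 < L ^ 2 + ξ ^ 2 := fun ξ => by positivity
  have hL2 : 0 < L ^ 2 := by positivity
  have hmeas : MeasurableSet {ξ : ℝ | R ^ 2 ≤ ξ ^ 2} := measurableSet_le measurable_const (by fun_prop)
  -- pointwise bound
  have hpt : ∀ ξ, |((L ^ 2 + ξ ^ 2) * χ' ξ ^ 2 + 2 * ξ * (χ ξ * χ' ξ) + (L ^ 2 + ξ ^ 2) * d ξ * (χ ξ * χ' ξ)) * u ξ ^ 2|
      ≤ C * {ξ : ℝ | R ^ 2 ≤ ξ ^ 2}.indicator (fun ξ => (L ^ 2 + ξ ^ 2) * u ξ ^ 2) ξ := by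
    intro ξ
    by_cases hz : χ' ξ = 0
    · rw [hz]
      simp only [zero_pow two_ne_zero, mul_zero, add_zero, zero_mul, abs_zero]
      refine mul_nonneg (by positivity) (Set.indicator_nonneg (fun y _ => by positivity) _)
    · -- on the transition region: `|ξ| ≤ 2R`, `R² ≤ ξ²`
      have hξ2R : |ξ| ≤ 2 * R := by
        by_contra hlt
        exact hz (cutoff_and_deriv_eq_zero hR0 (not_le.1 hlt).le).2
      have hRξ : R ^ 2 ≤ ξ ^ 2 := by
        by_contra hlt
        exact hz (deriv_cutoff_eq_zero_of_lt hR0 (not_le.1 hlt))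
      rw [Set.indicator_of_mem (show ξ ∈ {ξ : ℝ | R ^ 2 ≤ ξ ^ 2} from hRξ)]
      have hdξ : |d ξ| ≤ D₀ + 2 * D₁ * R := by
        calc |d ξ| ≤ D₀ + D₁ * |ξ| := hd ξ
          _ ≤ D₀ + D₁ * (2 * R) := by gcongr
          _ = D₀ + 2 * D₁ * R := by ring
      -- the three pieces
      have p1 : |(L ^ 2 + ξ ^ 2) * χ' ξ ^ 2| ≤ M ^ 2 * (L ^ 2 + ξ ^ 2) := by
        rw [abs_mul, abs_of_pos (hw ξ), abs_of_nonneg (sq_nonneg _), ← sq_abs (χ' ξ)]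
        nlinarith [pow_le_pow_left₀ (abs_nonneg _) (hχ'b ξ) 2, hw ξ]
      have p2 : |2 * ξ * (χ ξ * χ' ξ)| ≤ 4 * M / L ^ 2 * (L ^ 2 + ξ ^ 2) := by
        rw [abs_mul, abs_mul, abs_mul, abs_of_pos (by norm_num : (0:ℝ) < 2)]
        obtain ⟨hχ0, hχ1⟩ := hχb ξ
        rw [abs_of_nonneg hχ0]
        have h1 : 2 * |ξ| * (χ ξ * |χ' ξ|) ≤ 2 * (2 * R) * (1 * (M / R)) := by
          have e1 : χ ξ * |χ' ξ| ≤ 1 * (M / R) := mul_le_mul hχ1 (hχ'R ξ) (abs_nonneg _) zero_le_one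
          have e2 : 2 * |ξ| ≤ 2 * (2 * R) := by linarith
          exact mul_le_mul e2 e1 (mul_nonneg hχ0 (abs_nonneg _)) (by positivity)
        have h2 : 2 * (2 * R) * (1 * (M / R)) = 4 * M := by field_simp; ring
        have h3 : 4 * M ≤ 4 * M / L ^ 2 * (L ^ 2 + ξ ^ 2) := by
          rw [div_mul_eq_mul_div, le_div_iff₀ hL2]
          nlinarith [sq_nonneg ξ]
        linarith
      have p3 : |(L ^ 2 + ξ ^ 2) * d ξ * (χ ξ * χ' ξ)| ≤ M * (D₀ + 2 * D₁) * (L ^ 2 + ξ ^ 2) := by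
        rw [abs_mul, abs_mul, abs_mul, abs_of_pos (hw ξ)]
        obtain ⟨hχ0, hχ1⟩ := hχb ξ
        rw [abs_of_nonneg hχ0]
        have h1 : (L ^ 2 + ξ ^ 2) * |d ξ| * (χ ξ * |χ' ξ|) ≤ (L ^ 2 + ξ ^ 2) * (D₀ + 2 * D₁ * R) * (1 * (M / R)) := by
          have e1 : χ ξ * |χ' ξ| ≤ 1 * (M / R) := mul_le_mul hχ1 (hχ'R ξ) (abs_nonneg _) zero_le_one
          have e2 : (L ^ 2 + ξ ^ 2) * |d ξ| ≤ (L ^ 2 + ξ ^ 2) * (D₀ + 2 * D₁ * R) :=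
            mul_le_mul_of_nonneg_left hdξ (hw ξ).le
          exact mul_le_mul e2 e1 (mul_nonneg hχ0 (abs_nonneg _)) (by positivity)
        have h2 : (D₀ + 2 * D₁ * R) * (M / R) ≤ M * (D₀ + 2 * D₁) := by
          rw [mul_div_assoc', div_le_iff₀ hR0]
          nlinarith [mul_nonneg hM0 hD₀, mul_nonneg hM0 hD₁]
        calc (L ^ 2 + ξ ^ 2) * |d ξ| * (χ ξ * |χ' ξ|) ≤ (L ^ 2 + ξ ^ 2) * (D₀ + 2 * D₁ * R) * (1 * (M / R)) := h1
          _ = (L ^ 2 + ξ ^ 2) * ((D₀ + 2 * D₁ * R) * (M / R)) := by ring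
          _ ≤ (L ^ 2 + ξ ^ 2) * (M * (D₀ + 2 * D₁)) := mul_le_mul_of_nonneg_left h2 (hw ξ).le
          _ = M * (D₀ + 2 * D₁) * (L ^ 2 + ξ ^ 2) := by ring
      rw [abs_mul, abs_of_nonneg (sq_nonneg (u ξ))]
      have hsum := (abs_add_three _ _ _).trans (add_le_add (add_le_add p1 p2) p3)
      calc |(L ^ 2 + ξ ^ 2) * χ' ξ ^ 2 + 2 * ξ * (χ ξ * χ' ξ) + (L ^ 2 + ξ ^ 2) * d ξ * (χ ξ * χ' ξ)| * u ξ ^ 2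
          ≤ (M ^ 2 * (L ^ 2 + ξ ^ 2) + 4 * M / L ^ 2 * (L ^ 2 + ξ ^ 2) + M * (D₀ + 2 * D₁) * (L ^ 2 + ξ ^ 2)) * u ξ ^ 2 :=
            mul_le_mul_of_nonneg_right hsum (sq_nonneg _)
        _ = C * ((L ^ 2 + ξ ^ 2) * u ξ ^ 2) := by rw [hC]; ring
  -- integrability
  have hind : Integrable (fun ξ => {ξ : ℝ | R ^ 2 ≤ ξ ^ 2}.indicator (fun ξ => (L ^ 2 + ξ ^ 2) * u ξ ^ 2) ξ) :=
    h0.indicator hmeas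
  have hm : AEStronglyMeasurable (fun ξ => ((L ^ 2 + ξ ^ 2) * χ' ξ ^ 2 + 2 * ξ * (χ ξ * χ' ξ)
      + (L ^ 2 + ξ ^ 2) * d ξ * (χ ξ * χ' ξ)) * u ξ ^ 2) volume := by
    have h1 : AEStronglyMeasurable (fun ξ : ℝ => (L ^ 2 + ξ ^ 2) * χ' ξ ^ 2 + 2 * ξ * (χ ξ * χ' ξ)) volume := by
      exact (((by fun_prop : Continuous fun ξ : ℝ => L ^ 2 + ξ ^ 2).mul (hχ'c.pow 2)).add
        ((continuous_const.mul continuous_id).mul (hχc.mul hχ'c))).aestronglyMeasurable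
    have h2 : AEStronglyMeasurable (fun ξ : ℝ => (L ^ 2 + ξ ^ 2) * d ξ * (χ ξ * χ' ξ)) volume :=
      (((by fun_prop : Continuous fun ξ : ℝ => L ^ 2 + ξ ^ 2).aestronglyMeasurable.mul hdm).mul
        (hχc.mul hχ'c).aestronglyMeasurable)
    exact (h1.add h2).mul (huc.pow 2).aestronglyMeasurable
  have hint : Integrable (fun ξ => ((L ^ 2 + ξ ^ 2) * χ' ξ ^ 2 + 2 * ξ * (χ ξ * χ' ξ)
      + (L ^ 2 + ξ ^ 2) * d ξ * (χ ξ * χ' ξ)) * u ξ ^ 2) :=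
    (hind.const_mul C).mono' hm (Eventually.of_forall fun ξ => by rw [Real.norm_eq_abs]; exact hpt ξ)
  refine ⟨hpt, hint, ?_⟩
  calc ∫ ξ, ((L ^ 2 + ξ ^ 2) * χ' ξ ^ 2 + 2 * ξ * (χ ξ * χ' ξ) + (L ^ 2 + ξ ^ 2) * d ξ * (χ ξ * χ' ξ)) * u ξ ^ 2
      ≤ ∫ ξ, C * {ξ : ℝ | R ^ 2 ≤ ξ ^ 2}.indicator (fun ξ => (L ^ 2 + ξ ^ 2) * u ξ ^ 2) ξ :=
        integral_mono hint (hind.const_mul C) fun ξ => (le_abs_self _).trans (hpt ξ)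
    _ = C * ∫ ξ in {ξ : ℝ | R ^ 2 ≤ ξ ^ 2}, (L ^ 2 + ξ ^ 2) * u ξ ^ 2 := by
        rw [integral_const_mul, integral_indicator hmeas]

end Estimates

end SheetRLinearisedCutoffEstimates
end Summit.NavierStokesRegularity.OSWSelfSimilar

end
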